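import Mathlib
import HarnessLib
import Summits.HubbardSuperconductivity.HubbardSuperconductivity.Theorems.KLProgrammeH10TwoPointLimitKlAnisoNarrowConeCountFrame

/-!
# Route `KLProgramme` — K3 engine (stmt-HubbardSuperconductivity-20437), stub (b) (ℓ)/(I2), located item «ON-CLASS-KB» (K′), the `hNB`-shape corollary:
# the narrow class SUMMED OVER THE RECIPROCAL VECTOR — the coarse multiplicity of «on SOME umklapp class ∧ narrow» per pinned label

Cell gate-hubbard-kl, seat p4 g13 (memo HOME/prover-p4/CLAIM-U-API.md §3c, recipe `B := ON ∩ NARROW(Θ)`).  The consumer's on-class born norm `N_B` sums over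
the coarse tuples of the class with the pinned leg's label fixed; the class «on the umklapp class of SOME `G₀`» is the union over `G₀` of the classes counted
by `card_narrowCone_target_le_frame`, and only `|G₀ⱼ| ≤ m + 1` occur (each signed curve point has coordinates `≤ π√2 < 2π` in modulus and the tolerance is
`< π`).  Hence the multiplicity is at most `(2m+3)²` times the (K′) bound — uniformly in the scale.

* `card_onNarrow_pinned_le_frame` — frame level (`B, hA, hlo, hhi, 2A < Dt_min`);
* **`card_onNarrow_pinned_le_window`** — for every renormalisation package: `∃ c₃ U₀ Λ r₀ v₀`, for all admissible frames on `klWindowC`, all scales `k` and data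
  with `((m+1)C + mΛC′)·w_k < v₀` and `(m+1)·C·w_k < π`:
  `#{σ′ : σ′ p = ℓ ∧ (∃ G₀, ∀ j, |Σ_i ±k_F(centre_k(σ′ i)) j − 2πG₀ j| ≤ (m+1)Cw_k) ∧ ∃ b, ∀ i ≠ p, ∃ D, |D| ≤ C′ ∧ 2^k ∣ (ht(σ′ i) − b − D)}`
  `≤ (2m+3)²·2(8π((m+1)C + mΛC′)/r₀ + 2)·(8(2C′+1))^m`.
PROVED; no definitions, no named facts; nothing here asserts anything about the model or superconductivity. [folklore] counting.
-/

noncomputable section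

namespace Summit.HubbardSuperconductivity.HubbardSuperconductivity.Theorems.PerturbedFermiCurve

set_option linter.dupNamespace false -- summit = problem name (single-conjunct summit), D-0017

open Classical
open Real Set Finset
open Literature.MathematicalPhysics.QuantumLattice Literature.MathematicalPhysics.QuantumLattice.BandSectorCounting
open Literature.MathematicalPhysics.QuantumLattice.FermiRG Literature.MathematicalPhysics.QuantumLattice.FermiRG.BGM2003
open Summit.HubbardSuperconductivity.HubbardSuperconductivity.Theorems.DispersionFlow
open Summit.HubbardSuperconductivity.HubbardSuperconductivity.Theorems.KLRegimeSplit

/-! ## §1 Frame level -/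

section Frame

variable {a b : ℝ} (B : BandBounds a b) {K : TrigPolyC4v} {A : ℝ}
  (hA : ∀ p : Momentum, ∀ j ≤ 2, ‖iteratedFDeriv ℝ j (frameShift K) p‖ ≤ A) {μ : ℝ} (hlo : a ≤ μ - A) (hhi : μ + A ≤ b)
  (hDt : 2 * A < B.Dtmin)

include B hA hlo hhi hDt in
/-- **The narrow class summed over the reciprocal vector (frame level).**  Under the hypotheses of `card_narrowCone_target_le_frame` and `(m+1)·C·w_k < π`,
the coarse tuples with `σ′ p = ℓ`, on the umklapp class of SOME `G₀ ∈ ℤ²` (tolerance `(m+1)Cw_k`), and narrow (`C′`, modulo `2^k`) number at most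
`(2m+3)²·2(8π((m+1)C + m·Lip_A·C′)/u_min + 2)·(8(2C′+1))^m`. [folklore] -/
theorem card_onNarrow_pinned_le_frame {k m : ℕ} (p : Fin (m + 1)) (ℓ : SectorLeg (sectorCount k)) {C : ℝ} (hC : 0 ≤ C) (C' : ℕ)
    (hsmall : (((m : ℝ) + 1) * C + m * (π * Real.sqrt 2 * (1 + (4 + 2 * A) / (B.Dtmin - 2 * A))) * C') * sectorWidth k <
      min (B.umin / 2) (2 * π - π * Real.sqrt 2))
    (hπC : ((m : ℝ) + 1) * C * sectorWidth k < π) :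
    (((univ : Finset (Fin (m + 1) → SectorLeg (sectorCount k))).filter fun σ' =>
        σ' p = ℓ ∧
        (∃ G₀ : Fin 2 → ℤ, ∀ j : Fin 2, |∑ i, (if (σ' i).2 = 0 then klFermiPoint μ K (sectorCenter k (σ' i).1.1) j
            else -klFermiPoint μ K (sectorCenter k (σ' i).1.1) j) - 2 * π * (G₀ j : ℝ)| ≤ ((m : ℝ) + 1) * C * sectorWidth k) ∧
        ∃ b : Fin (sectorCount k), ∀ i, i ≠ p → ∃ D : ℤ, |D| ≤ C' ∧ ((2 : ℤ) ^ k) ∣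
          ((((if (σ' i).2 = 0 then ((σ' i).1.1 : ℕ) else
              if ((σ' i).1.1 : ℕ) < 2 ^ k then ((σ' i).1.1 : ℕ) + 2 ^ k else ((σ' i).1.1 : ℕ) - 2 ^ k : ℕ) : ℤ)) - b - D)).card : ℝ) ≤
      (2 * ((m : ℝ) + 1) + 1) ^ 2 *
        (2 * (8 * π * (((m : ℝ) + 1) * C + m * (π * Real.sqrt 2 * (1 + (4 + 2 * A) / (B.Dtmin - 2 * A))) * C') / B.umin + 2) *
          (8 * (2 * (C' : ℝ) + 1)) ^ m) := by
  have hw := sectorWidth_pos k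
  have humin := B.umin_pos
  -- the per-`G₀` classes and their bound
  set SG : (Fin 2 → ℤ) → Finset (Fin (m + 1) → SectorLeg (sectorCount k)) := fun G₀ =>
    (univ : Finset (Fin (m + 1) → SectorLeg (sectorCount k))).filter fun σ' =>
      σ' p = ℓ ∧
      (∀ j : Fin 2, |∑ i, (if (σ' i).2 = 0 then klFermiPoint μ K (sectorCenter k (σ' i).1.1) j
          else -klFermiPoint μ K (sectorCenter k (σ' i).1.1) j) - 2 * π * (G₀ j : ℝ)| ≤ ((m : ℝ) + 1) * C * sectorWidth k) ∧
      ∃ b : Fin (sectorCount k), ∀ i, i ≠ p → ∃ D : ℤ, |D| ≤ C' ∧ ((2 : ℤ) ^ k) ∣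
        ((((if (σ' i).2 = 0 then ((σ' i).1.1 : ℕ) else
            if ((σ' i).1.1 : ℕ) < 2 ^ k then ((σ' i).1.1 : ℕ) + 2 ^ k else ((σ' i).1.1 : ℕ) - 2 ^ k : ℕ) : ℤ)) - b - D) with hSG
  have hSG_card : ∀ G₀, ((SG G₀).card : ℝ) ≤
      2 * (8 * π * (((m : ℝ) + 1) * C + m * (π * Real.sqrt 2 * (1 + (4 + 2 * A) / (B.Dtmin - 2 * A))) * C') / B.umin + 2) *
        (8 * (2 * (C' : ℝ) + 1)) ^ m :=
    fun G₀ => card_narrowCone_target_le_frame B hA hlo hhi hDt p ℓ G₀ hC C' hsmall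
  -- the box of reciprocal vectors
  set Box : Finset (Fin 2 → ℤ) := Fintype.piFinset fun _ : Fin 2 => Finset.Icc (-((m : ℤ) + 1)) ((m : ℤ) + 1) with hBox
  have hBox_card : (Box.card : ℝ) = (2 * ((m : ℝ) + 1) + 1) ^ 2 := by
    rw [hBox, Fintype.card_piFinset, Finset.prod_const, Finset.card_univ, Fintype.card_fin, Int.card_Icc]
    have e : ((m : ℤ) + 1 + 1 - -((m : ℤ) + 1)).toNat = 2 * (m + 1) + 1 := by
      have : (m : ℤ) + 1 + 1 - -((m : ℤ) + 1) = ((2 * (m + 1) + 1 : ℕ) : ℤ) := by push_cast; ring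
      rw [this, Int.toNat_natCast]
    rw [e]; push_cast; ring
  -- each signed curve point has coordinates `≤ π√2` in modulus
  have hcoord : ∀ (θ : ℝ) (c : Fin 2) (j : Fin 2),
      |(if c = 0 then klFermiPoint μ K θ j else -klFermiPoint μ K θ j)| ≤ π * Real.sqrt 2 := by
    intro θ c j
    have hule := frameRadius_le B hA hlo hhi θ
    have hupos := frameRadius_pos B hA hlo hhi θ
    have hPt : klFermiPoint μ K θ = perturbedFermiRadius (fun q : Fin 2 → ℝ => -K.eval q) μ θ • dir θ := rfl
    have h1 : |klFermiPoint μ K θ j| ≤ π * Real.sqrt 2 := by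
      rw [hPt]
      fin_cases j
      · simp only [Pi.smul_apply, smul_eq_mul, dir_zero, Fin.zero_eta]
        rw [abs_mul, abs_of_pos hupos]; nlinarith [Real.abs_cos_le_one θ, abs_nonneg (Real.cos θ)]
      · simp only [Pi.smul_apply, smul_eq_mul, dir_one, Fin.mk_one]
        rw [abs_mul, abs_of_pos hupos]; nlinarith [Real.abs_sin_le_one θ, abs_nonneg (Real.sin θ)]
    split_ifs
    · exact h1
    · rw [abs_neg]; exact h1
  have hsqrt2 : Real.sqrt 2 < 2 := by
    rw [show (2 : ℝ) = Real.sqrt 4 from by rw [show (4 : ℝ) = 2 ^ 2 by norm_num, Real.sqrt_sq (by norm_num : (0 : ℝ) ≤ 2)]]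
    exact Real.sqrt_lt_sqrt (by norm_num) (by norm_num)
  -- cover
  have hcover : ((univ : Finset (Fin (m + 1) → SectorLeg (sectorCount k))).filter fun σ' =>
      σ' p = ℓ ∧
      (∃ G₀ : Fin 2 → ℤ, ∀ j : Fin 2, |∑ i, (if (σ' i).2 = 0 then klFermiPoint μ K (sectorCenter k (σ' i).1.1) j
          else -klFermiPoint μ K (sectorCenter k (σ' i).1.1) j) - 2 * π * (G₀ j : ℝ)| ≤ ((m : ℝ) + 1) * C * sectorWidth k) ∧
      ∃ b : Fin (sectorCount k), ∀ i, i ≠ p → ∃ D : ℤ, |D| ≤ C' ∧ ((2 : ℤ) ^ k) ∣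
        ((((if (σ' i).2 = 0 then ((σ' i).1.1 : ℕ) else
            if ((σ' i).1.1 : ℕ) < 2 ^ k then ((σ' i).1.1 : ℕ) + 2 ^ k else ((σ' i).1.1 : ℕ) - 2 ^ k : ℕ) : ℤ)) - b - D)) ⊆
      Box.biUnion SG := by
    intro σ' hσ'
    rw [mem_filter] at hσ'
    obtain ⟨-, hσp, ⟨G₀, hG₀⟩, hb⟩ := hσ'
    rw [Finset.mem_biUnion]
    refine ⟨G₀, ?_, ?_⟩
    · rw [hBox, Fintype.mem_piFinset]
      intro j
      rw [Finset.mem_Icc]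
      -- `|2πG₀ j| ≤ (m+1)π√2 + (m+1)Cw < 2π(m+2)`
      have hsum : |∑ i, (if (σ' i).2 = 0 then klFermiPoint μ K (sectorCenter k (σ' i).1.1) j
          else -klFermiPoint μ K (sectorCenter k (σ' i).1.1) j)| ≤ ((m : ℝ) + 1) * (π * Real.sqrt 2) := by
        calc |∑ i, (if (σ' i).2 = 0 then klFermiPoint μ K (sectorCenter k (σ' i).1.1) j
                else -klFermiPoint μ K (sectorCenter k (σ' i).1.1) j)|
            ≤ ∑ i, |(if (σ' i).2 = 0 then klFermiPoint μ K (sectorCenter k (σ' i).1.1) j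
                else -klFermiPoint μ K (sectorCenter k (σ' i).1.1) j)| := Finset.abs_sum_le_sum_abs _ _
          _ ≤ ∑ _i : Fin (m + 1), π * Real.sqrt 2 := Finset.sum_le_sum fun i _ => hcoord _ _ _
          _ = ((m : ℝ) + 1) * (π * Real.sqrt 2) := by
              rw [Finset.sum_const, nsmul_eq_mul, Finset.card_univ, Fintype.card_fin]; push_cast; ring
      have h1 := hG₀ j
      have h2 : |2 * π * (G₀ j : ℝ)| ≤ ((m : ℝ) + 1) * (π * Real.sqrt 2) + ((m : ℝ) + 1) * C * sectorWidth k := by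
        have := abs_sub_abs_le_abs_sub (2 * π * (G₀ j : ℝ))
          (∑ i, (if (σ' i).2 = 0 then klFermiPoint μ K (sectorCenter k (σ' i).1.1) j else -klFermiPoint μ K (sectorCenter k (σ' i).1.1) j))
        rw [abs_sub_comm] at this
        linarith
      have h3 : |(G₀ j : ℝ)| < (m : ℝ) + 2 := by
        rw [abs_mul, abs_of_pos (by positivity : (0 : ℝ) < 2 * π)] at h2
        have hm1 : (0 : ℝ) < (m : ℝ) + 1 := by positivity
        have h2b : ((m : ℝ) + 1) * (π * Real.sqrt 2) < ((m : ℝ) + 1) * (2 * π) :=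
          mul_lt_mul_of_pos_left (by nlinarith [Real.pi_pos, hsqrt2]) hm1
        have h2c : 2 * π * |(G₀ j : ℝ)| < 2 * π * ((m : ℝ) + 2) := by nlinarith [Real.pi_pos]
        exact lt_of_mul_lt_mul_left h2c (by positivity)
      have h4 : |G₀ j| < (m : ℤ) + 2 := by
        have : ((|G₀ j| : ℤ) : ℝ) < (m : ℝ) + 2 := by rw [Int.cast_abs]; exact h3
        exact_mod_cast this
      have h5 := abs_lt.1 h4
      constructor <;> omega
    · rw [hSG, mem_filter]; exact ⟨mem_univ _, hσp, hG₀, hb⟩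
  have hX : (0 : ℝ) ≤ 2 * (8 * π * (((m : ℝ) + 1) * C + m * (π * Real.sqrt 2 * (1 + (4 + 2 * A) / (B.Dtmin - 2 * A))) * C') / B.umin + 2) *
      (8 * (2 * (C' : ℝ) + 1)) ^ m := le_trans (Nat.cast_nonneg _) (hSG_card 0)
  calc _ ≤ ((Box.biUnion SG).card : ℝ) := by exact_mod_cast Finset.card_le_card hcover
    _ ≤ ∑ G₀ ∈ Box, ((SG G₀).card : ℝ) := by exact_mod_cast Finset.card_biUnion_le
    _ ≤ ∑ _G₀ ∈ Box, 2 * (8 * π * (((m : ℝ) + 1) * C + m * (π * Real.sqrt 2 * (1 + (4 + 2 * A) / (B.Dtmin - 2 * A))) * C') / B.umin + 2) *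
          (8 * (2 * (C' : ℝ) + 1)) ^ m := Finset.sum_le_sum fun G₀ _ => hSG_card G₀
    _ = _ := by rw [Finset.sum_const, nsmul_eq_mul, hBox_card]

end Frame

/-! ## §2 Window level -/

/-- **The narrow class summed over the reciprocal vector, for ADMISSIBLE frames in the KL regime** (`hNB`-shape multiplicity).  For every renormalisation
package `R` (`Gfr ≥ 0`) there are `c₃, U₀ > 0`, `Λ ≥ 0`, `r₀, v₀ > 0` — package/window constants — such that for all KL binders, `μ ∈ klWindowC`, every frame
with `FrameOK R U (nScales β) ν K`, every scale `k` and all data with `((m+1)C + mΛC′)·w_k < v₀` and `(m+1)·C·w_k < π`: the coarse tuples with `σ′ p = ℓ`, on the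
umklapp class of SOME `G₀` and narrow (`C′`, modulo `2^k`) number at most `(2m+3)²·2(8π((m+1)C + mΛC′)/r₀ + 2)·(8(2C′+1))^m`. [folklore] -/
theorem card_onNarrow_pinned_le_window (R : RenConsts) (hR : ∀ j, 0 ≤ R.Gfr j) :
    ∃ c₃ : ℝ, 0 < c₃ ∧ ∃ U₀ : ℝ, 0 < U₀ ∧ ∃ Λ : ℝ, 0 ≤ Λ ∧ ∃ r₀ : ℝ, 0 < r₀ ∧ ∃ v₀ : ℝ, 0 < v₀ ∧
      ∀ c : ℝ, 0 < c → c ≤ c₃ → ∀ U : ℝ, 0 < U → U ≤ U₀ → ∀ β : ℝ, klBetaMin ≤ β → β ≤ Real.exp (c / U ^ 2) →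
      ∀ μ ∈ klWindowC, ∀ (ν : ℝ) (K : TrigPolyC4v), FrameOK R U (nScales β) ν K →
      ∀ (k m : ℕ) (p : Fin (m + 1)) (ℓ : SectorLeg (sectorCount k)) (C : ℝ), 0 ≤ C → ∀ C' : ℕ,
      (((m : ℝ) + 1) * C + m * Λ * C') * sectorWidth k < v₀ → ((m : ℝ) + 1) * C * sectorWidth k < π →
      (((univ : Finset (Fin (m + 1) → SectorLeg (sectorCount k))).filter fun σ' =>
          σ' p = ℓ ∧
          (∃ G₀ : Fin 2 → ℤ, ∀ j : Fin 2, |∑ i, (if (σ' i).2 = 0 then klFermiPoint μ K (sectorCenter k (σ' i).1.1) j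
              else -klFermiPoint μ K (sectorCenter k (σ' i).1.1) j) - 2 * π * (G₀ j : ℝ)| ≤ ((m : ℝ) + 1) * C * sectorWidth k) ∧
          ∃ b : Fin (sectorCount k), ∀ i, i ≠ p → ∃ D : ℤ, |D| ≤ C' ∧ ((2 : ℤ) ^ k) ∣
            ((((if (σ' i).2 = 0 then ((σ' i).1.1 : ℕ) else
                if ((σ' i).1.1 : ℕ) < 2 ^ k then ((σ' i).1.1 : ℕ) + 2 ^ k else ((σ' i).1.1 : ℕ) - 2 ^ k : ℕ) : ℤ)) - b - D)).card : ℝ) ≤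
        (2 * ((m : ℝ) + 1) + 1) ^ 2 * (2 * (8 * π * (((m : ℝ) + 1) * C + m * Λ * C') / r₀ + 2) * (8 * (2 * (C' : ℝ) + 1)) ^ m) := by
  have ha : (-4 : ℝ) < -1.1 := by norm_num
  have hab : (-1.1 : ℝ) ≤ -0.1 := by norm_num
  have hb : (-0.1 : ℝ) < 0 := by norm_num
  set B := bandBounds ha hab hb with hBdef
  have hDt := B.Dtmin_pos
  set κ : ℝ := min B.Dtmin (1 / 5) with hκdef
  have hκ : 0 < κ := lt_min hDt (by norm_num)
  obtain ⟨c₃, hc₃, U₀, hU₀, hthr⟩ := frame_thresholds hR hκ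
  set Λ : ℝ := π * Real.sqrt 2 * (1 + (4 + B.Dtmin) / (B.Dtmin / 2)) with hΛdef
  have hΛ0 : 0 ≤ Λ := by positivity
  have hv₀ : 0 < min (B.umin / 2) (2 * π - π * Real.sqrt 2) := lt_min (by linarith [B.umin_pos]) two_pi_sub_pi_sqrt_two_pos
  refine ⟨c₃, hc₃, U₀, hU₀, Λ, hΛ0, B.umin, B.umin_pos, _, hv₀, ?_⟩
  intro c hc hcle U hU hUle β hβmin hβc μ hμ ν K hK k m p ℓ C hC C' hsmall hπC
  have hAf : ∀ p : Momentum, ∀ j ≤ 2, ‖iteratedFDeriv ℝ j (frameShift K) p‖ ≤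
      2 * R.Gfr 0 * |U| + 2 * R.Gfr 1 * U ^ 2 + R.Gfr 2 * (c / Real.log 4) := fun p j hj =>
    norm_iteratedFDeriv_frameShift_le_of_frameOK_regime hR hc.le hβmin hβc hK p hj
  set A := 2 * R.Gfr 0 * |U| + 2 * R.Gfr 1 * U ^ 2 + R.Gfr 2 * (c / Real.log 4) with hAdef
  have h4A : 4 * A ≤ κ := hthr c U hc.le hcle hU hUle
  have hA0 : 0 ≤ A := le_trans (norm_nonneg _) (hAf 0 0 (by norm_num))
  have hκDt : κ ≤ B.Dtmin := min_le_left _ _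
  have hκ5 : κ ≤ 1 / 5 := min_le_right _ _
  have hADt : 2 * A < B.Dtmin := by linarith
  have hA20 : A ≤ 1 / 20 := by linarith
  obtain ⟨hlo, hhi⟩ := PerturbedFermiCurve.klWindowC_margin hμ hA20
  have hden : B.Dtmin / 2 ≤ B.Dtmin - 2 * A := by linarith
  have hfrac : (4 + 2 * A) / (B.Dtmin - 2 * A) ≤ (4 + B.Dtmin) / (B.Dtmin / 2) := by
    rw [div_le_div_iff₀ (by linarith) (by linarith)]
    nlinarith
  have hΛ1 : π * Real.sqrt 2 * (1 + (4 + 2 * A) / (B.Dtmin - 2 * A)) ≤ Λ := by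
    rw [hΛdef]
    apply mul_le_mul_of_nonneg_left _ (by positivity)
    linarith
  have hw := sectorWidth_pos k
  have hC'0 : (0 : ℝ) ≤ C' := Nat.cast_nonneg _
  have hm0 : (0 : ℝ) ≤ m := Nat.cast_nonneg _
  have hmono : ((m : ℝ) + 1) * C + m * (π * Real.sqrt 2 * (1 + (4 + 2 * A) / (B.Dtmin - 2 * A))) * C' ≤
      ((m : ℝ) + 1) * C + m * Λ * C' := by
    have : m * (π * Real.sqrt 2 * (1 + (4 + 2 * A) / (B.Dtmin - 2 * A))) * C' ≤ m * Λ * C' := by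
      apply mul_le_mul_of_nonneg_right _ hC'0
      exact mul_le_mul_of_nonneg_left hΛ1 hm0
    linarith
  have hsmall' : (((m : ℝ) + 1) * C + m * (π * Real.sqrt 2 * (1 + (4 + 2 * A) / (B.Dtmin - 2 * A))) * C') * sectorWidth k <
      min (B.umin / 2) (2 * π - π * Real.sqrt 2) :=
    lt_of_le_of_lt (mul_le_mul_of_nonneg_right hmono hw.le) hsmall
  have h := card_onNarrow_pinned_le_frame B hAf hlo hhi hADt p ℓ hC C' hsmall' hπC
  refine h.trans (mul_le_mul_of_nonneg_left ?_ (by positivity))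
  refine mul_le_mul_of_nonneg_right ?_ (by positivity)
  have hu := B.umin_pos
  have hnum : 8 * π * (((m : ℝ) + 1) * C + m * (π * Real.sqrt 2 * (1 + (4 + 2 * A) / (B.Dtmin - 2 * A))) * C') ≤
      8 * π * (((m : ℝ) + 1) * C + m * Λ * C') := by nlinarith [Real.pi_pos]
  have := div_le_div_of_nonneg_right hnum hu.le
  linarith

end Summit.HubbardSuperconductivity.HubbardSuperconductivity.Theorems.PerturbedFermiCurve

end
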